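import Literature.Topology.FourManifolds.CoupleRigidity
import Literature.Topology.FourManifolds.CoupleExtension
import Literature.Topology.FourManifolds.ConeRadialExtension

/-!
# The structure conjugacy of two one-level Morse data on a `3`-manifold, from a diffeomorphism
# of the sphere of directions with prescribed germs at the core directions

Topic `Literature/Topology/FourManifolds` (eleventh file of the *structure conjugacy*, support of
`stmt-SmoothPoincare4-15190`; dimension `3`, saddles of index `1`, same minimum value and same
saddle value on both sides).  Everything here is **proved**.

Let `C` be a couple of basin settings on a compact `3`-manifold with boundary `W` with saddle data
`Q` (boxes of index `1`, `g_B p₀' = g_A p₀`, `c_B = c_A`), and let `φ` be a diffeomorphism of the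
unit sphere which, **in the entrance charts of the saddles, is the identity near every core
direction** — `φ (unit (QA.entDir s b y)) = unit (QB.entDir (σ s) b y)` for `‖y‖² < δ₀`, and the
same for `φ⁻¹` with `σ⁻¹`.  Then:

* `Adm.of_sphereDiffeo` — the cone `sphereCone φ` (`CoupleRigidity.lean`) is an admissible
  direction map (`CouplePsi.lean`): rigid at every saddle, and the `B`-rays of the image
  directions of basin points meet the image levels (a non-core direction goes to a non-core
  direction, `not_hits_ofChart_iff`);
* `exists_conjData_of_sphereDiffeo` — with Cerf's cone diffeomorphism of `ℝ³` over `φ`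
  (`exists_diffeomorph_norm_eq_eq_cone_two`, Smale's theorem) the data of `CoupleExtension.lean`
  are complete, so **the induced boundary diffeomorphism `bret_B ∘ Ψ₁ ∘ push_A` of `∂W` extends to
  the self-diffeomorphism `pull_B ∘ Ψ₁ ∘ push_A` of `W`** (`diffeoExtends_of_sphereDiffeo`).

What remains for the structure conjugacy of two handle structures is the existence of such a `φ`
(disc theorem on `S²` at the `2g` core directions) and the identification of the traces of the
co-cores under the boundary diffeomorphism.

## References

* J. Milnor, *Lectures on the h-cobordism theorem* (1965), Def. 3.9, Thm. 4.1, proofs of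
  Thms. 3.12–3.13 (PDF pp. 16–22). [MilnorHCobordism1965]
* J. Cerf, *Sur les difféomorphismes de la sphère de dimension trois (Γ₄ = 0)*, LNM 53 (1968),
  Ch. I §1, Lemme 2; Appendice. [CerfDiffeoSphere1968]
-/

open scoped Manifold ContDiff Topology
open Set Function Filter Metric

noncomputable section

namespace Literature.Topology.FourManifolds

open Cobordism FourManifolds.Flow TracePolar

universe u

attribute [local instance] fact_finrank_euclideanSpace_succ

namespace BasinCouple

namespace SaddleData

variable {W : Type u} [TopologicalSpace W] [T2Space W] [SecondCountableTopology W]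
  [CompactSpace W] [ChartedSpace (EuclideanHalfSpace (2 + 1)) W] [IsManifold (𝓡∂ (2 + 1)) ∞ W]
  {gA gB : W → ℝ} {ξA ξB : Π x : W, TangentSpace (𝓡∂ (2 + 1)) x} {C : BasinCouple gA gB ξA ξB}
  (Q : C.SaddleData)

/-- Local notation for the model plane and space. -/
local notation "E2" => EuclideanSpace ℝ (Fin 2)
local notation "E3" => EuclideanSpace ℝ (Fin 3)

/-! ### Basin points reach the level `L` unless they lie below the saddle value -/

/-- **A basin point of level `≥ c_A` (below `hi`) meets the level `L`**: its forward orbit is not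
caught by a saddle (the stable sets of the saddles lie strictly below `c_A` off the saddles). [cite: MilnorHCobordism1965, Thm. 4.1 (PDF p. 22)] -/
theorem hits_L_of_c_le {x : W} (hx : x ∈ C.A.basin) (hx0 : x ≠ C.A.p₀) (hxc : Q.QA.c ≤ gA x) (hxhi : gA x < C.A.hi) :
    Hits C.A.θ gA C.A.L x := by
  have hxnc : ¬ IsMCriticalPt (𝓡∂ (2 + 1)) gA x := C.A.not_isMCriticalPt_of_mem_basin hx hx0 hxhi.le
  rcases le_or_gt C.A.L (gA x) with hL | hL
  · exact C.A.hits_L_of_L_le hL hxhi.le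
  rcases C.A.preSlabFlow.exists_lt_or_exists_tendsto_atTop (x := x) (C.A.lo_lt_apply x).le with ⟨t, ht0, ht⟩ | ⟨p, hp, hpI, hconv, -⟩
  · obtain ⟨τ, -, hτ⟩ := intermediate_value_Icc ht0 (C.A.continuous_apply_θ x).continuousOn
      ⟨by rw [C.A.θ_zero]; exact hL.le, (C.A.L_lt_hi.trans ht).le⟩
    exact ⟨τ, hτ⟩
  · exfalso
    -- `p` is a saddle of value `c_A = g_A x`, and the orbit is constant
    have hpne : p ≠ C.A.p₀ := fun h => by
      rw [h] at hpI; exact (lt_irrefl _ ((C.A.apply_p₀_lt hx0).trans_le hpI.1))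
    have hps : gA p = Q.QA.c := Q.QA.apply_eq_c ⟨p, hp, C.A.morseIndex_ne_zero hp hpne⟩
    have hgc : Continuous gA := C.A.isMorseFunction.isMorse.contMDiff.continuous
    have hlim : Tendsto (fun τ => gA (C.A.θ (τ, x))) atTop (𝓝 Q.QA.c) := by rw [← hps]; exact (hgc.tendsto _).comp hconv
    have hle : ∀ τ, gA (C.A.θ (τ, x)) ≤ Q.QA.c := fun τ => (C.A.monotone_apply_θ x).ge_of_tendsto hlim τ
    have hfix : ∀ τ, 0 ≤ τ → C.A.θ (τ, x) = x := fun τ hτ =>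
      C.A.θ_eq_of_apply_eq hxnc (C.A.apply_mem_slab hxhi)
        (le_antisymm ((hle τ).trans hxc) (by simpa [C.A.θ_zero] using C.A.monotone_apply_θ x hτ))
    have hconst : Tendsto (fun τ => C.A.θ (τ, x)) atTop (𝓝 x) :=
      tendsto_const_nhds.congr' (by filter_upwards [eventually_ge_atTop (0 : ℝ)] with τ hτ using (hfix τ hτ).symm)
    have := tendsto_nhds_unique hconv hconst
    exact hxnc (this ▸ hp)

/-! ### Admissibility of the cone of a map of the sphere of directions -/

variable (hkA : ∀ s, (Q.QA.DA s).k = 1) (hkB : ∀ s', (Q.QB.DA s').k = 1)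
  (h₀ : gB C.B.p₀ = gA C.A.p₀) (hc : Q.QB.c = Q.QA.c)

/-- **The germ condition** on a map `φ` of the unit sphere for the saddle data `Q` along `σ`: in
the entrance charts of the saddles `φ` is the identity on the discs `‖y‖² < δ₀`. [cite: MilnorHCobordism1965, proof of Thm. 3.13 (PDF pp. 18–19)] -/
def GermCond (φ : Metric.sphere (0 : E3) 1 → Metric.sphere (0 : E3) 1) (δ₀ : ℝ) : Prop :=
  ∀ (s : SaddlePt 2 gA) (b : Bool) (y : E2), ‖y‖ ^ 2 < δ₀ →
    (φ (unitVec (Q.QA.entDir s b y)) : E3) = C.A.rad⁻¹ • Q.QB.entDir (Q.σ s) b y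

variable {Q} {φ ψ : Metric.sphere (0 : E3) 1 → Metric.sphere (0 : E3) 1} {δ₀ : ℝ}

/-- The germ condition is inherited by smaller widths. [folklore] -/
theorem GermCond.mono (hφ : Q.GermCond φ δ₀) {δ₁ : ℝ} (h : δ₁ ≤ δ₀) : Q.GermCond φ δ₁ :=
  fun s b y hy => hφ s b y (hy.trans_le h)

/-- Under the germ condition `φ` carries the unit core directions of `A` to those of `B`. [folklore] -/
theorem GermCond.apply_coreDir (hφ : Q.GermCond φ δ₀) (hδ₀ : 0 < δ₀) (s : SaddlePt 2 gA) (b : Bool) :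
    (φ (unitVec (Q.QA.coreDir s b)) : E3) = C.A.rad⁻¹ • Q.QB.coreDir (Q.σ s) b :=
  hφ s b 0 (by rw [norm_zero]; simpa using hδ₀)

include hkA hkB in
/-- **The germ condition for `φ` gives the germ condition for `φ⁻¹` on the swapped data** (widths
`≤ ε²`): apply `φ⁻¹` to the identity of unit vectors. [folklore] -/
theorem GermCond.symm_swap (φ : Metric.sphere (0 : E3) 1 ≃ₘ⟮𝓡 2, 𝓡 2⟯ Metric.sphere (0 : E3) 1) (hφ : Q.GermCond φ δ₀)
    (hδ₀ε : δ₀ ≤ Q.QA.ε ^ 2) : Q.swap.GermCond φ.symm δ₀ := by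
  intro s' b y hy
  set s : SaddlePt 2 gA := Q.σ.symm s' with hs
  have hs' : Q.σ s = s' := Q.σ.apply_symm_apply s'
  have hyA : ‖y‖ ^ 2 < Q.QA.ε ^ 2 := hy.trans_le hδ₀ε
  have hyB : ‖y‖ ^ 2 < Q.QB.ε ^ 2 := by rw [Q.εB_eq]; exact hyA
  have h := hφ s b y hy
  rw [hs'] at h
  -- `φ (unit entDir_A) = unit entDir_B` as points of the sphere
  have hB0 : Q.QB.entDir s' b y ≠ 0 := by
    rw [← norm_pos_iff, Q.QB.norm_entDir (hkB s') hyB]; exact C.B.rad_pos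
  have h1 : φ (unitVec (Q.QA.entDir s b y)) = unitVec (Q.QB.entDir s' b y) := by
    apply Subtype.ext
    rw [h, coe_unitVec hB0, Q.QB.norm_entDir (hkB s') hyB]
    show C.A.rad⁻¹ • Q.QB.entDir s' b y = C.B.rad⁻¹ • Q.QB.entDir s' b y
    rw [C.rad_eq]
  have hA0 : Q.QA.entDir s b y ≠ 0 := by
    rw [← norm_pos_iff, Q.QA.norm_entDir (hkA s) hyA]; exact C.A.rad_pos
  show (φ.symm (unitVec (Q.QB.entDir s' b y)) : E3) = C.B.rad⁻¹ • Q.QA.entDir (Q.σ.symm s') b y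
  rw [← h1, φ.symm_apply_apply, coe_unitVec hA0, Q.QA.norm_entDir (hkA s) hyA, ← hs, C.rad_eq]
  rfl

include hkA hkB h₀ hc in
/-- **The `B`-rays of the image directions of basin points meet the image levels** (for the cone
of `φ`, under the germ condition for a left inverse `ψ` of `φ` on the swapped data):
below `c` every ray serves; above `c` the direction of a basin point is not a core direction of
`A`, hence its image is not a core direction of `B`. [cite: MilnorHCobordism1965, Def. 3.9, Thm. 4.1] -/
theorem hits_sphereCone (hψ : Q.swap.GermCond ψ δ₀) (hψφ : LeftInverse ψ φ) (hδ₀ : 0 < δ₀)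
    {x : W} (hx : x ∈ C.A.basin) (hx0 : x ≠ C.A.p₀) (hxhi : gA x < C.A.hi) :
    Hits C.B.θ gB (gA x) (C.B.ofChart (sphereCone φ (C.A.dir x))) := by
  have hhit : Hits C.A.θ gA C.A.sphR x := C.A.hits_sphR_of_mem_basin hx hx0 hxhi.le
  have hnd : ‖C.A.dir x‖ = C.A.rad := C.A.norm_dir hhit
  have hd0 : C.A.dir x ≠ 0 := by rw [← norm_pos_iff, hnd]; exact C.A.rad_pos
  have hTn : ‖sphereCone φ (C.A.dir x)‖ = C.B.rad := by rw [norm_sphereCone, hnd, C.rad_eq]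
  set w : W := C.B.ofChart (sphereCone φ (C.A.dir x)) with hw
  have hwℓ : gB w = C.B.sphR := (C.B.apply_ofChart_eq_sphR_iff (C.B.norm_lt_r₀_of_eq_rad hTn).le).2 hTn
  have hxI : gA x ∈ Ioo (gA C.A.p₀) C.A.hi := ⟨C.A.apply_p₀_lt hx0, hxhi⟩
  rcases lt_or_ge (gA x) Q.QA.c with hlt | hge
  · -- below `c`: every `B`-ray serves
    have h1 : gB w ∈ Ioo (gB (BasinPair.diag C.B).A.p₀) Q.QB.c := by
      rw [hwℓ]; exact ⟨C.B.sphR_mem_Ioo.1, C.B.sphR_lt_sph.trans Q.QB.sph_lt_c⟩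
    refine Q.QB.hits_A_of_mem_Ioo_p₀_c h1 ?_
    show gA x ∈ Ioo (gB C.B.p₀) Q.QB.c
    rw [h₀, hc]; exact ⟨hxI.1, hlt⟩
  · -- above `c`: the direction of `x` is not a core direction
    have hxL : Hits C.A.θ gA C.A.L x := Q.hits_L_of_c_le hx hx0 hge hxhi
    have hwL : Hits C.B.θ gB C.B.L w := by
      by_contra hnot
      obtain ⟨s', b, hv⟩ := (Q.QB.not_hits_ofChart_iff hkB hTn).1 hnot
      -- `φ (unit (dir x))` is the unit core direction of `B` at `(s', b)` ...
      have hc0 : Q.QB.coreDir s' b ≠ 0 := by rw [← norm_pos_iff, Q.QB.norm_coreDir (hkB s')]; exact C.B.rad_pos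
      have hu : φ (unitVec (C.A.dir x)) = unitVec (Q.QB.coreDir s' b) := by
        apply Subtype.ext
        have h1 : sphereCone φ (C.A.dir x) = C.A.rad • (φ (unitVec (C.A.dir x)) : E3) := sphereCone_of_norm_eq hnd
        rw [hv] at h1
        rw [coe_unitVec hc0, h1, norm_smul, Real.norm_of_nonneg C.A.rad_pos.le,
          mem_sphere_zero_iff_norm.1 (φ (unitVec (C.A.dir x))).2, mul_one, smul_smul, inv_mul_cancel₀ C.A.rad_pos.ne', one_smul]
      -- ... so `dir x` is the core direction of `A` at `(σ⁻¹ s', b)`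
      have hdir : C.A.dir x = Q.QA.coreDir (Q.σ.symm s') b := by
        have h2 := hψ.apply_coreDir (Q := Q.swap) hδ₀ s' b
        change (ψ (unitVec (Q.QB.coreDir s' b)) : E3) = C.B.rad⁻¹ • Q.QA.coreDir (Q.σ.symm s') b at h2
        rw [← hu, hψφ] at h2
        have h3 := eq_norm_smul_unitVec hd0
        rw [hnd, h2, smul_smul, C.rad_eq, mul_inv_cancel₀ C.A.rad_pos.ne', one_smul] at h3
        exact h3
      have hnot' : ¬ Hits C.A.θ gA C.A.L (C.A.ofChart (C.A.dir x)) := by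
        rw [hdir]; exact Q.QA.not_hits_L_ofChart_coreDir (hkA _)
      rw [C.A.ofChart_dir hhit, C.A.hits_levelProj_iff] at hnot'
      exact hnot' hxL
    -- from the level-`L` point of the ray, all levels of `(g_B p₀', hi)` are met
    have hwb : w ∈ C.B.basin := C.B.ofChart_mem_basin (C.B.norm_lt_r₀_of_eq_rad hTn)
    set w' := levelProj C.B.θ gB C.B.L w with hw'
    have hw'L : gB w' = C.B.L := C.B.apply_levelProj hwL
    have hw'b : w' ∈ C.B.basin := by
      rw [hw', levelProj_apply]
      refine (C.B.θ_mem_basin_iff (by rw [hwℓ]; exact C.B.sphR_mem_Ioo.2.le) ?_).2 hwb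
      show gB w' ≤ C.B.hi
      rw [hw'L]; exact C.B.L_lt_hi.le
    have h3 : Hits C.B.θ gB (gA x) w' :=
      C.B.hits_of_mem_basin_of_apply_eq_L hw'b hw'L (by rw [h₀, C.hi_eq]; exact hxI)
    rw [hw', C.B.hits_levelProj_iff] at h3
    exact h3

include hkA hkB h₀ hc in
/-- **The cone of `φ` is admissible, with widths `δ, ρ`**, under the germ conditions (`δ₀ ≤ ε²`)
for a smooth `φ` with a left inverse `ψ` satisfying the germ condition on the swapped data; the
widths depend only on `δ₀` and `ε`. [cite: MilnorHCobordism1965, Thm. 4.1, proof of Thm. 3.13] -/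
theorem adm_sphereCone (hφs : ContMDiff (𝓡 2) (𝓡 2) ∞ φ) (hφ : Q.GermCond φ δ₀) (hψ : Q.swap.GermCond ψ δ₀)
    (hψφ : LeftInverse ψ φ) (hδ₀ : 0 < δ₀) (hδ₀ε : δ₀ ≤ Q.QA.ε ^ 2) :
    Q.Adm (LevelMap.ofEq Q h₀ hc) (sphereCone φ) (δ₀ / 4) (min Q.QA.ε (Real.sqrt (Real.sqrt (δ₀ * Q.QA.ε ^ 2)))) := by
  have hε := Q.QA.ε_pos
  set ρ : ℝ := min Q.QA.ε (Real.sqrt (Real.sqrt (δ₀ * Q.QA.ε ^ 2))) with hρ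
  have hprod : 0 < δ₀ * Q.QA.ε ^ 2 := by positivity
  have hρ0 : 0 < ρ := lt_min hε (Real.sqrt_pos.2 (Real.sqrt_pos.2 hprod))
  have hρ4 : ρ ^ 4 ≤ δ₀ * Q.QA.ε ^ 2 := by
    have h1 : ρ ≤ Real.sqrt (Real.sqrt (δ₀ * Q.QA.ε ^ 2)) := min_le_right _ _
    have h2 : ρ ^ 2 ≤ Real.sqrt (δ₀ * Q.QA.ε ^ 2) := by
      have := pow_le_pow_left₀ hρ0.le h1 2
      rwa [Real.sq_sqrt (Real.sqrt_nonneg _)] at this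
    have h3 := pow_le_pow_left₀ (pow_nonneg hρ0.le 2) h2 2
    rw [Real.sq_sqrt hprod.le] at h3
    nlinarith
  refine ⟨by linarith, by linarith, hρ0, min_le_left _ _, ?_, fun s => ?_, fun v hv => ?_, fun v hv => ?_, fun x hx hx0 hxhi => ?_⟩
  · rw [div_lt_iff₀ (by positivity)]; nlinarith
  · have h4 : 4 * (δ₀ / 4) = δ₀ := by ring
    rw [h4]
    exact Q.tRigid_sphereCone (hkA s) hδ₀ε fun b y hy => hφ s b y hy
  · rw [norm_sphereCone, hv]
  · exact contDiffAt_sphereCone hφs (by rw [← norm_pos_iff, hv]; exact C.A.rad_pos)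
  · exact Q.hits_sphereCone hkA hkB h₀ hc hψ hψφ hδ₀ hx hx0 hxhi

/-! ### The conjugacy data and the extension -/

include hkA hkB in
/-- **The data of the structure conjugacy from a diffeomorphism `φ` of the sphere of directions
with the germ conditions** (same minimum value and saddle value on both sides): the cones of `φ`
and `φ⁻¹` are admissible for the couple and its swap, and Cerf's cone diffeomorphism `Θ` of `ℝ³`
over `φ` (Smale's theorem, `exists_diffeomorph_norm_eq_eq_cone_two`) with its inverse completes
the data. [cite: MilnorHCobordism1965, Thm. 4.1] [cite: CerfDiffeoSphere1968, Ch. I §1, Lemme 2; Appendice §5] -/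
theorem exists_conjData_of_sphereDiffeo (φ : Metric.sphere (0 : E3) 1 ≃ₘ⟮𝓡 2, 𝓡 2⟯ Metric.sphere (0 : E3) 1)
    (hφ : Q.GermCond φ δ₀) (hδ₀ : 0 < δ₀) (hδ₀ε : δ₀ ≤ Q.QA.ε ^ 2) :
    ∃ (δ ρ : ℝ) (Θ : E3 ≃ₘ⟮𝓘(ℝ, E3), 𝓘(ℝ, E3)⟯ E3),
      Q.ConjData (LevelMap.ofEq Q h₀ hc) (sphereCone φ) (sphereCone φ.symm) Θ Θ.symm δ ρ := by
  have hφ' : Q.swap.GermCond φ.symm δ₀ := GermCond.symm_swap hkA hkB φ hφ hδ₀ε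
  have hA := Q.adm_sphereCone hkA hkB h₀ hc φ.contMDiff hφ hφ' φ.symm_apply_apply hδ₀ hδ₀ε
  have hA' := Q.swap.adm_sphereCone hkB hkA h₀.symm hc.symm φ.symm.contMDiff hφ' hφ φ.apply_symm_apply hδ₀
    (by rw [swap_QA, Q.εB_eq]; exact hδ₀ε)
  obtain ⟨Θ, hΘn, hΘc⟩ := exists_diffeomorph_norm_eq_eq_cone_two φ C.A.rad_pos
  have hΘn' : ∀ v, ‖Θ.symm v‖ = ‖v‖ := fun v => by conv_rhs => rw [← Θ.apply_symm_apply v]; rw [hΘn]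
  refine ⟨δ₀ / 4, min Q.QA.ε (Real.sqrt (Real.sqrt (δ₀ * Q.QA.ε ^ 2))), Θ, ⟨hA, ?_, fun v _ => ?_, fun v _ => ?_,
    Θ.symm_apply_apply, Θ.apply_symm_apply, Θ.contMDiff, Θ.symm.contMDiff, hΘn, hΘn', fun v hv1 hv2 => ?_, fun v hv1 hv2 => ?_⟩⟩
  · have h : min Q.QB.ε (Real.sqrt (Real.sqrt (δ₀ * Q.QB.ε ^ 2))) = min Q.QA.ε (Real.sqrt (Real.sqrt (δ₀ * Q.QA.ε ^ 2))) := by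
      rw [Q.εB_eq]
    rw [← h]; exact hA'
  · exact sphereCone_sphereCone φ.symm_apply_apply v
  · exact sphereCone_sphereCone φ.apply_symm_apply v
  · -- `Θ` is the cone of `sphereCone φ` on the shell
    have hv0 : v ≠ 0 := fun h => by rw [h, norm_zero] at hv1; linarith [C.A.rad_pos]
    have hdecomp := eq_norm_smul_unitVec hv0
    have h1 : (C.A.rad / ‖v‖) • v = C.A.rad • (unitVec v : E3) := by rw [coe_unitVec hv0, smul_smul, div_eq_mul_inv]
    have h2 : Θ v = ‖v‖ • (φ (unitVec v) : E3) := by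
      conv_lhs => rw [hdecomp]
      exact hΘc _ _ hv1 hv2
    rw [h1, sphereCone_smul_coe C.A.rad_pos, smul_smul, div_mul_cancel₀ _ C.A.rad_pos.ne']
    exact h2
  · -- `Θ⁻¹` is the cone of `sphereCone φ⁻¹` on the shell
    rw [C.rad_eq] at hv1 hv2 ⊢
    have hv0 : v ≠ 0 := fun h => by rw [h, norm_zero] at hv1; linarith [C.A.rad_pos]
    have hdecomp := eq_norm_smul_unitVec hv0
    have h1 : Θ (‖v‖ • (φ.symm (unitVec v) : E3)) = v := by
      rw [hΘc _ _ hv1 hv2, φ.apply_symm_apply]; exact hdecomp.symm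
    have h2 : Θ.symm v = ‖v‖ • (φ.symm (unitVec v) : E3) :=
      Θ.injective (show Θ (Θ.symm v) = Θ _ by rw [Θ.apply_symm_apply, h1])
    have h3 : (C.A.rad / ‖v‖) • v = C.A.rad • (unitVec v : E3) := by rw [coe_unitVec hv0, smul_smul, div_eq_mul_inv]
    rw [h3, sphereCone_smul_coe C.A.rad_pos, smul_smul, div_mul_cancel₀ _ C.A.rad_pos.ne']
    exact h2

variable [Nonempty (BoundaryManifold.boundaryData 2 W).carrier]

/-! ### The traces under the induced boundary map -/

section Traces

variable {M : Q.LevelMap} {T T' Θ Θ' : E3 → E3} {δ ρ : ℝ}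

/-- **The induced boundary map carries the trace of `s` into the trace of `σ s`**: the push of a
trace point lies in the exit domain of `s`, where `Ψ₁` is the exit transport, whose value lies on
the `ξ_B`-trajectory of a point of the unstable disc of the box of `σ s`. [cite: MilnorHCobordism1965, Def. 3.9, proofs of Thms. 3.12–3.13 (PDF pp. 16–19)] -/
theorem bdryMap_mem_traceOf (hA : Q.Adm M T δ ρ) {s : SaddlePt 2 gA} {y : (𝓡∂ (2 + 1)).boundary W}
    (hy : y ∈ C.A.traceOf s) : Q.bdryMap M T Θ δ ρ y ∈ C.B.traceOf (Q.σ s) := by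
  have hε := Q.QA.ε_pos
  set x : W := C.A.push (y : W) with hx
  have hxL : gA x = C.A.L := C.A.apply_push_coe y
  have hxhi : gA x < C.A.hi := by rw [hxL]; exact C.A.L_lt_hi
  have hxc : ¬ IsMCriticalPt (𝓡∂ (2 + 1)) gA x := C.A.not_isMCriticalPt_of_eq_L hxL
  have hconv : Tendsto (fun τ => C.A.θ (τ, x)) atBot (𝓝 s.1) := (C.A.mem_traceOf_iff_tendsto).1 hy
  -- the exit point `z` of the trajectory of `x`
  obtain ⟨τ, hzball, hzℓ, hz0, hcx⟩ := Q.QA.exists_exit_of_tendsto_atBot (x := x) hxhi hxc hconv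
  set z : W := C.A.θ (τ, x) with hz
  have hz3 : z ∈ (Q.QA.DA s).chartBall (3 * Q.QA.ε) := hzball
  have hz0' : sqSumLT (Q.QA.DA s).k ((Q.QA.DA s).coord z) = 0 := hz0
  have hzℓ' : gA z = Q.QA.c + Q.QA.ε ^ 2 := hzℓ
  have hdom : x ∈ (Q.refExit M s (2 * δ)).dom := by
    refine Q.QA.mem_dom_refExit ⟨hcx, hxhi⟩ ?_
    have h1 : levelProj C.A.θ gA (Q.QA.c + Q.QA.ε ^ 2) x = z :=
      (BasinPair.diag C.A).levelProj_A_eq_θ hxc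
        ⟨Q.QA.apply_p₀_lt_c.trans (lt_add_of_pos_right _ Q.QA.sq_pos), Q.QA.c_add_sq_lt_hi⟩ hzℓ'
    show levelProj C.A.θ gA (Q.QA.c + Q.QA.ε ^ 2) x ∈ Q.QA.Uexit s (2 * δ)
    rw [h1]
    exact ⟨hz3, by rw [hz0']; linarith [hA.δ_pos]⟩
  have href : (Q.refExit M s (2 * δ)).ref x = z := by
    rw [RefData.ref_def, refExit_ℓ₀]
    exact (BasinPair.diag C.A).levelProj_A_eq_θ hxc
      ⟨Q.QA.apply_p₀_lt_c.trans (lt_add_of_pos_right _ Q.QA.sq_pos), Q.QA.c_add_sq_lt_hi⟩ hzℓ'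
  -- the value of `Ψ₁` at `x`
  set w : W := Q.psi₁ M T Θ δ ρ x with hw
  have hw1 : w = (Q.refExit M s (2 * δ)).LT x := by
    rw [hw, psi₁_of_le (by rw [hxL]; exact (C.A.sphR_lt_sph.trans C.A.sph_lt_L).le), psi0_eq_LT_refExit hA hdom]
  have hwL : gB w = C.B.L := by rw [hw1, RefData.apply_LT hdom, hxL, M.lam_L, C.L_eq]
  -- the backward orbit of `MC s z` converges to `σ s`
  have hMCsrc : Q.MC s z ∈ (Q.QB.DA (Q.σ s)).chart.source := Q.MC_mem_source hz3.2.le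
  have hMC0 : sqSumLT (Q.QB.DA (Q.σ s)).k ((Q.QB.DA (Q.σ s)).coord (Q.MC s z)) = 0 := by
    rw [Q.sqSumLT_coord_MC hz3.2.le]; exact hz0'
  have hMCB : sqSumGE (Q.QB.DA (Q.σ s)).k ((Q.QB.DA (Q.σ s)).coord (Q.MC s z)) ≤ 4 * (Q.QB.DA (Q.σ s)).ε ^ 2 := by
    rw [Q.sqSumGE_coord_MC hz3.2.le, Q.ε_DB]
    have h1 := sqSumLT_add_sqSumGE (Q.QA.DA s).k ((Q.QA.DA s).coord z)
    have h2 : ‖(Q.QA.DA s).coord z‖ ^ 2 ≤ (3 * Q.QA.ε) ^ 2 := pow_le_pow_left₀ (norm_nonneg _) hz3.2.le 2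
    -- on the exit level with `x⃗ = 0`: `|y⃗|² = ε²`
    have h3 : milnorQuadratic (Q.QA.DA s).k ((Q.QA.DA s).coord z) = Q.QA.ε ^ 2 := by
      have h := Q.QA.apply_eq_of_mem_chartBall hz3; rw [hzℓ'] at h; linarith
    rw [milnorQuadratic_eq, hz0'] at h3
    nlinarith
  have hconvB : Tendsto (fun t => C.B.θ (t, Q.MC s z)) atBot (𝓝 (Q.σ s).1) :=
    (Q.QB.DA (Q.σ s)).tendsto_atBot_of_sqSumLT_eq_zero C.B.isFlowOf_X hMCsrc hMC0 hMCB
  -- `w` lies on the `ξ_B`-trajectory of `MC s z`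
  have hw2 : w = C.B.θ (hittingTime C.B.θ gB (M.lam (gA x)) (Q.MC s z), Q.MC s z) := by
    rw [hw1, RefData.LT_def, refExit_Φ, href]; rfl
  have hconvw : Tendsto (fun t => C.B.θ (t, w)) atBot (𝓝 (Q.σ s).1) := by
    rw [hw2]; exact (C.B.tendsto_θ_atBot_iff _).2 hconvB
  -- the boundary point of `w`
  have hpush : C.B.push (Q.bdryMap M T Θ δ ρ y : W) = w := by
    rw [bdryMap_def, ← hx, ← hw, C.B.coe_bret (by rw [hwL]; exact C.B.one_sub_a'_lt_L.le), C.B.push_ret_of_apply_eq_L hwL]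
  rw [C.B.mem_traceOf_iff_tendsto, hpush]
  exact hconvw

/-- **The induced boundary diffeomorphism matches the traces**: `bdryMap y` lies on the trace of
`σ s` iff `y` lies on the trace of `s`. [cite: MilnorHCobordism1965, Def. 3.9] -/
theorem bdryDiffeomorph_mem_traceOf_iff (h : Q.ConjData M T T' Θ Θ' δ ρ) (s : SaddlePt 2 gA) (y : (𝓡∂ (2 + 1)).boundary W) :
    Q.bdryDiffeomorph M h y ∈ C.B.traceOf (Q.σ s) ↔ y ∈ C.A.traceOf s := by
  refine ⟨fun hy => ?_, fun hy => Q.bdryMap_mem_traceOf h.adm hy⟩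
  have h1 := Q.swap.bdryMap_mem_traceOf (M := M.swap) (Θ := Θ') h.adm' hy
  have h2 : Q.swap.bdryMap M.swap T' Θ' δ ρ (Q.bdryDiffeomorph M h y) = y := (Q.bdryDiffeomorph M h).symm_apply_apply y
  rw [h2] at h1
  have h3 : Q.swap.σ (Q.σ s) = s := Q.σ.symm_apply_apply s
  rw [h3] at h1
  exact h1

end Traces

include hkA hkB h₀ hc in
/-- **Structure conjugacy from a diffeomorphism of the sphere of directions with the germ
conditions**: there is a self-diffeomorphism `G` of `∂W` (the induced boundary diffeomorphism
`bret_B ∘ Ψ₁ ∘ push_A`) which extends to a self-diffeomorphism of `W` (to `pull_B ∘ Ψ₁ ∘ push_A`) and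
carries the trace of every saddle `s` of `A` onto the trace of `σ s`. [cite: MilnorHCobordism1965, Thm. 4.1] [cite: CerfDiffeoSphere1968, Ch. I §1, Lemme 2] -/
theorem diffeoExtends_of_sphereDiffeo (φ : Metric.sphere (0 : E3) 1 ≃ₘ⟮𝓡 2, 𝓡 2⟯ Metric.sphere (0 : E3) 1)
    (hφ : Q.GermCond φ δ₀) (hδ₀ : 0 < δ₀) (hδ₀ε : δ₀ ≤ Q.QA.ε ^ 2) :
    ∃ G : (𝓡∂ (2 + 1)).boundary W ≃ₘ⟮𝓡 2, 𝓡 2⟯ (𝓡∂ (2 + 1)).boundary W,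
      (BoundaryManifold.boundaryData 2 W).DiffeoExtends G ∧ ∀ s y, G y ∈ C.B.traceOf (Q.σ s) ↔ y ∈ C.A.traceOf s := by
  obtain ⟨δ, ρ, Θ, h⟩ := Q.exists_conjData_of_sphereDiffeo hkA hkB h₀ hc φ hφ hδ₀ hδ₀ε
  exact ⟨Q.bdryDiffeomorph _ h, diffeoExtends_bdryDiffeomorph h, Q.bdryDiffeomorph_mem_traceOf_iff h⟩

end SaddleData

end BasinCouple

end Literature.Topology.FourManifolds
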